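import Literature.Analysis.FluidPDE.Axisymmetric
import HarnessLib

/-!
# From dynamic-rescaling stability to finite-time blow-up (Chen–Hou, CMP 2021, §4.1)

Topic `Literature/Analysis/FluidPDE`. This file proves, once and for all, the elementary
real-analysis bookkeeping by which every *dynamic rescaling* (modulation) blow-up proof for an
inviscid fluid equation passes from "the rescaled solution stays nontrivial for all rescaled times
`τ ≥ 0`" to "the physical solution blows up at the finite time `T = t(∞)`". It is item 6 of the
proof architecture of the Chen–Hou theorem recorded in `ChenHouBlowup.lean`
(`Literature.Analysis.FluidPDE.ChenHou2022_axisymmetricEulerBlowup`; Part I, arXiv:2210.07191, p. 66: "Passing from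
nonlinear stability to finite time blowup ... follows the argument in [chen2019finite2]"), and the
argument of `[ChenHou2021Boundary]` = [chen2019finite2], §4.1, p. 11 of the held text, which we
vendor here *with proofs*.

## The printed argument ([ChenHou2021Boundary], §4.1 "Dynamic rescaling formulation", p. 11)

With rescaling exponents `c_ω(τ)`, `c_l(τ)` one puts (eqs. (4.1)–(4.3))
`ω̃(x, τ) = C_ω(τ) ω(C_l(τ) x, t(τ))`, `C_ω(τ) = exp(∫₀^τ c_ω(s) ds)`,
`C_l(τ) = exp(−∫₀^τ c_l)`, and the rescaled time `t(τ) = ∫₀^τ C_ω(s) ds`. "If there exists `C > 0`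
such that for any `τ > 0`, `c_ω(τ) ≤ −C < 0` and the solution `ω̃` is nontrivial, e.g.
`‖ω̃(τ, ·)‖_{L^∞} ≥ c > 0` for all `τ > 0`, we then have `C_ω(τ) ≤ e^{−Cτ}`,
`t(∞) ≤ ∫₀^∞ e^{−Cτ} dτ = C⁻¹ < +∞`, and that
`|ω(C_l(τ)x, t(τ))| = C_ω(τ)⁻¹ |ω̃(x, τ)| ≥ e^{Cτ}|ω̃(x, τ)|` blows up at finite time `T = t(∞)`."
The same passage is §8.6.2 "Finite time blowup" (p. 41) of that paper for the `C^{1,α}` result,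
and Chen–Hou Part I uses the same formulation with a general initial factor `C_ω(0)` (§6, p. 53:
`ω(x, y, τ) = C_ω(τ) ω̃(1 − C_l(τ)y, C_l(τ)x, t(τ))`, `C_ω(τ) = C_ω(0) exp(∫₀^τ c_ω)`,
`t(τ) = ∫₀^τ C_ω`) and the bound `c̄_ω + c_ω < −1/2` for the
total exponent (§6.5, p. 66).

## What is proved here (all `theorem`s, no named facts)

* `Fluid.rescaledTime C τ = ∫₀^τ C` and `Fluid.blowupTime C = ∫_{(0,∞)} C` (`= t(∞)`), the
  rescaling factor `Fluid.rescalingFactor c τ = exp(∫₀^τ c)` ((4.3) with `C_ω(0) = 1`); for a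
  continuous positive `C`, `t` is continuous and strictly increasing, and if `C` is integrable on
  `(0, ∞)` then `t(τ) → T = blowupTime C`, `t(τ) < T`, `0 < T`
  (`tendsto_rescaledTime`, `rescaledTime_lt_blowupTime`, `blowupTime_pos`), and
  `liminf_{τ→∞} C = 0` in the form `∃ᶠ τ → ∞, C τ < ε` (`frequently_lt_of_integrableOn`).
* Transfer along `t`: properties holding for `t(τ)` frequently/eventually as `τ → ∞` hold
  frequently/eventually as `s ↑ T` (`frequently_nhdsLT_of_frequently_atTop`, and the
  intermediate-value version `tendsto_nhdsLT_of_tendsto_comp_atTop`).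
* The printed statement: under `c ≤ −a < 0` on `[0, ∞)`, `C_ω(τ) ≤ e^{−aτ}`
  (`rescalingFactor_le_exp_neg`), `C_ω` is integrable on `(0, ∞)` with `T = t(∞) ≤ a⁻¹`
  (`blowupTime_rescalingFactor_le`), and a physical size functional `N` with
  `C_ω(τ) · N(t(τ)) ≥ m > 0` (i.e. `‖ω̃(τ)‖ ≥ m`, by (4.1)) tends to `+∞` as `t ↑ T`
  (`tendsto_atTop_nhdsLT_of_rescalingFactor`).
* Without any decay rate (only `T = ∫₀^∞ C_ω < ∞`, which is all that "`T < +∞`" asserts), the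
  `limsup` form of blow-up used by the accepted blow-up predicates: pointwise lower bounds
  `m ≤ C(τ) · F(t(τ), x_τ)` at points `x_τ ∈ Ω` give `∀ M, ∃ᶠ s ↑ T, ∃ x ∈ Ω, M < F(s, x)`
  (`frequently_exists_lt_nhdsLT_of_rescaling`), whence `NS.VorticityBlowsUpOnAt Ω u T`
  (`NS.vorticityBlowsUpOnAt_of_rescaling`) and its scalar variant (`NS.scalar_blowup_of_rescaling`,
  for `ω^θ = NS.angularVorticity`: the shape of the last conjunct of
  `NS.ChenHou2022_axisymmetricEulerBlowup` in `ChenHouBlowup.lean`).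

Hypotheses are taken on all of `ℝ` where the source has them on `τ ≥ 0` only when this costs
nothing to a user (a factor defined for `τ ≥ 0` extends continuously and positively by a
constant to `τ < 0`; only `τ ≥ 0` enters `t` and `T`).

Mathlib has the ingredients but no packaged statement (searched `rescal`, `modulation`,
`blowupTime`: nothing). Used: `intervalIntegral.continuous_primitive`,
`intervalIntegral.intervalIntegral_pos_of_pos`, `intervalIntegral.integral_add_adjacent_intervals`,
`MeasureTheory.intervalIntegral_tendsto_integral_Ioi`, `Monotone.ge_of_tendsto`,
`intermediate_value_Icc`, `mem_nhdsLT_iff_exists_Ioo_subset`, `exp_neg_integrableOn_Ioi`,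
`integral_exp_mul_Ioi`, `Filter.Tendsto.frequently`.
-/

noncomputable section

open MeasureTheory Set Filter Topology intervalIntegral

namespace Literature.Analysis.FluidPDE

/-! ### Transfer of asymptotic statements from rescaled time `τ → ∞` to physical time `s ↑ T` -/

section Transfer

variable {t : ℝ → ℝ} {T : ℝ}

/-- If the physical time `t(τ)` tends to `T` from below as `τ → ∞`, then a property of physical
times that holds at `t(τ)` for arbitrarily large `τ` holds for times arbitrarily close to `T` from
below (pure filter bookkeeping: `t` tends to `𝓝[<] T`). [folklore] -/
theorem frequently_nhdsLT_of_frequently_atTop (hT : Tendsto t atTop (𝓝 T))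
    (hlt : ∀ᶠ τ in atTop, t τ < T) {p : ℝ → Prop} (hp : ∃ᶠ τ in atTop, p (t τ)) :
    ∃ᶠ s in 𝓝[<] T, p s :=
  (tendsto_nhdsWithin_iff.2 ⟨hT, hlt⟩).frequently hp

/-- If the physical time `t(τ)` depends continuously on `τ`, stays below `T` and tends to `T` as
`τ → ∞`, then every physical time `s ∈ (t(A), T)` is of the form `t(τ)` with `τ ≥ A`
(intermediate value theorem). [folklore] -/
theorem exists_ge_rescaledTime_eq (ht : Continuous t) (hT : Tendsto t atTop (𝓝 T)) (A : ℝ)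
    {s : ℝ} (hs : s ∈ Ioo (t A) T) : ∃ τ, A ≤ τ ∧ t τ = s := by
  obtain ⟨τ₂, hAτ₂, hsτ₂⟩ :=
    ((eventually_ge_atTop A).and (hT.eventually (lt_mem_nhds hs.2))).exists
  obtain ⟨τ, hτ, hτs⟩ :=
    intermediate_value_Icc hAτ₂ ht.continuousOn ⟨hs.1.le, hsτ₂.le⟩
  exact ⟨τ, hτ.1, hτs⟩

/-- If the physical time `t(τ)` depends continuously on `τ`, stays below `T` and tends to `T` as
`τ → ∞`, then any limit statement for `g (t τ)` as `τ → ∞` transfers to `g s` as `s ↑ T`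
(e.g. `‖ω(t(τ))‖_∞ → ∞` gives `‖ω(s)‖_∞ → ∞` as `s ↑ T`). [folklore] -/
theorem tendsto_nhdsLT_of_tendsto_comp_atTop (ht : Continuous t) (hT : Tendsto t atTop (𝓝 T))
    (hlt : ∀ τ, t τ < T) {α : Type*} {l : Filter α} {g : ℝ → α}
    (hg : Tendsto (g ∘ t) atTop l) : Tendsto g (𝓝[<] T) l := by
  rw [tendsto_iff_forall_eventually_mem]
  intro U hU
  obtain ⟨A, hA⟩ := eventually_atTop.1 (hg.eventually_mem hU)
  refine mem_nhdsLT_iff_exists_Ioo_subset.2 ⟨t A, hlt A, fun s hs => ?_⟩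
  obtain ⟨τ, hAτ, rfl⟩ := exists_ge_rescaledTime_eq ht hT A hs
  exact hA τ hAτ

end Transfer

/-! ### Rescaled time, blow-up time, rescaling factor -/

/-- The **rescaled (physical) time** `t(τ) = ∫₀^τ C_ω(s) ds` of the dynamic rescaling formulation
with vorticity rescaling factor `C = C_ω` ([ChenHou2021Boundary], §4.1, after (4.3); Chen–Hou
Part I, §6, p. 53). [cite: ChenHou2021Boundary, §4.1 eq. (4.3), p. 11] -/
def rescaledTime (C : ℝ → ℝ) (τ : ℝ) : ℝ :=
  ∫ s in (0 : ℝ)..τ, C s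

/-- The **blow-up time** `T = t(∞) = ∫₀^∞ C_ω(s) ds` of the dynamic rescaling formulation
([ChenHou2021Boundary], §4.1, p. 11: "blows up at finite time `T = t(∞)`"). It is the limit of
`rescaledTime C τ` as `τ → ∞` when `C` is integrable (`tendsto_rescaledTime`); junk (the Bochner
integral's `0`) otherwise. [cite: ChenHou2021Boundary, §4.1, p. 11] -/
def blowupTime (C : ℝ → ℝ) : ℝ :=
  ∫ s in Ioi (0 : ℝ), C s

/-- The **rescaling factor** `C_ω(τ) = exp(∫₀^τ c_ω(s) ds)` generated by a rescaling exponent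
`c = c_ω` ([ChenHou2021Boundary], §4.1, eq. (4.3), normalised by `C_ω(0) = 1`).
[cite: ChenHou2021Boundary, §4.1 eq. (4.3), p. 11] -/
def rescalingFactor (c : ℝ → ℝ) (τ : ℝ) : ℝ :=
  Real.exp (∫ s in (0 : ℝ)..τ, c s)

section Time

variable {C : ℝ → ℝ}

/-- `t(0) = 0`. [folklore] -/
@[simp]
theorem rescaledTime_zero (C : ℝ → ℝ) : rescaledTime C 0 = 0 :=
  integral_same

/-- Unfolding the rescaled time. [folklore] -/
theorem rescaledTime_apply (C : ℝ → ℝ) (τ : ℝ) : rescaledTime C τ = ∫ s in (0 : ℝ)..τ, C s :=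
  rfl

/-- Unfolding the blow-up time. [folklore] -/
theorem blowupTime_eq (C : ℝ → ℝ) : blowupTime C = ∫ s in Ioi (0 : ℝ), C s :=
  rfl

/-- Additivity of the rescaled time: `t(b) = t(a) + ∫_a^b C`. [folklore] -/
theorem rescaledTime_add_integral (hC : Continuous C) (a b : ℝ) :
    rescaledTime C a + ∫ s in a..b, C s = rescaledTime C b :=
  integral_add_adjacent_intervals (hC.intervalIntegrable 0 a) (hC.intervalIntegrable a b)

/-- The rescaled time is continuous in `τ` (for a continuous factor). [folklore] -/
theorem continuous_rescaledTime (hC : Continuous C) : Continuous (rescaledTime C) :=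
  continuous_primitive (fun a b => hC.intervalIntegrable a b) 0

/-- The rescaled time is strictly increasing (for a continuous positive factor). [folklore] -/
theorem strictMono_rescaledTime (hC : Continuous C) (hpos : ∀ τ, 0 < C τ) :
    StrictMono (rescaledTime C) := by
  intro a b hab
  have h := rescaledTime_add_integral hC a b
  have hp : 0 < ∫ s in a..b, C s :=
    intervalIntegral_pos_of_pos (hC.intervalIntegrable a b) hpos hab
  linarith

/-- The rescaled time is monotone (for a continuous positive factor). [folklore] -/
theorem monotone_rescaledTime (hC : Continuous C) (hpos : ∀ τ, 0 < C τ) :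
    Monotone (rescaledTime C) :=
  (strictMono_rescaledTime hC hpos).monotone

/-- `t(τ) ≥ 0` for `τ ≥ 0`. [folklore] -/
theorem rescaledTime_nonneg (hC : Continuous C) (hpos : ∀ τ, 0 < C τ) {τ : ℝ} (hτ : 0 ≤ τ) :
    0 ≤ rescaledTime C τ := by
  simpa using monotone_rescaledTime hC hpos hτ

/-- `t(τ) → T = t(∞)` as `τ → ∞` when the factor is integrable on `(0, ∞)`
([ChenHou2021Boundary], §4.1: `T = t(∞)`). [folklore] -/
theorem tendsto_rescaledTime (hint : IntegrableOn C (Ioi 0)) :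
    Tendsto (rescaledTime C) atTop (𝓝 (blowupTime C)) :=
  intervalIntegral_tendsto_integral_Ioi 0 hint tendsto_id

/-- `t(τ) ≤ T` for every `τ`. [folklore] -/
theorem rescaledTime_le_blowupTime (hC : Continuous C) (hpos : ∀ τ, 0 < C τ)
    (hint : IntegrableOn C (Ioi 0)) (τ : ℝ) : rescaledTime C τ ≤ blowupTime C :=
  (monotone_rescaledTime hC hpos).ge_of_tendsto (tendsto_rescaledTime hint) τ

/-- `t(τ) < T` for every `τ`: the physical solution lives on `[0, T)`. [folklore] -/
theorem rescaledTime_lt_blowupTime (hC : Continuous C) (hpos : ∀ τ, 0 < C τ)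
    (hint : IntegrableOn C (Ioi 0)) (τ : ℝ) : rescaledTime C τ < blowupTime C :=
  (strictMono_rescaledTime hC hpos (lt_add_one τ)).trans_le
    (rescaledTime_le_blowupTime hC hpos hint (τ + 1))

/-- `0 < T`. [folklore] -/
theorem blowupTime_pos (hC : Continuous C) (hpos : ∀ τ, 0 < C τ) (hint : IntegrableOn C (Ioi 0)) :
    0 < blowupTime C := by
  simpa using rescaledTime_lt_blowupTime hC hpos hint 0

/-- The rescaled time tends to `T` *from below*. [folklore] -/
theorem tendsto_rescaledTime_nhdsLT (hC : Continuous C) (hpos : ∀ τ, 0 < C τ)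
    (hint : IntegrableOn C (Ioi 0)) :
    Tendsto (rescaledTime C) atTop (𝓝[<] (blowupTime C)) :=
  tendsto_nhdsWithin_iff.2
    ⟨tendsto_rescaledTime hint, Eventually.of_forall (rescaledTime_lt_blowupTime hC hpos hint)⟩

/-- **`liminf_{τ → ∞} C_ω(τ) = 0`** when `T = ∫₀^∞ C_ω < ∞`: a continuous positive factor that is
integrable on `(0, ∞)` takes values below any `ε > 0` at arbitrarily large rescaled times
(otherwise `t(A + T/ε) − t(A) ≥ T`). This is what makes `C_ω(τ)⁻¹ ‖ω̃(τ)‖` unbounded.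
[folklore] -/
theorem frequently_lt_of_integrableOn (hC : Continuous C) (hpos : ∀ τ, 0 < C τ)
    (hint : IntegrableOn C (Ioi 0)) {ε : ℝ} (hε : 0 < ε) : ∃ᶠ τ in atTop, C τ < ε := by
  by_contra h
  rw [not_frequently] at h
  obtain ⟨A, hA⟩ := eventually_atTop.1 h
  set A' := max A 0 with hA'
  have hT : 0 < blowupTime C := blowupTime_pos hC hpos hint
  set L := blowupTime C / ε with hL
  have hL0 : 0 ≤ L := div_nonneg hT.le hε.le
  have hLε : L * ε = blowupTime C := div_mul_cancel₀ _ hε.ne'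
  -- lower bound `∫_{A'}^{A'+L} C ≥ L ε = T`
  have h1 : L * ε ≤ ∫ s in A'..(A' + L), C s := by
    have hmono := integral_mono_on (le_add_of_nonneg_right hL0)
      (intervalIntegrable_const (μ := volume)) (hC.intervalIntegrable _ _)
      (fun x hx => not_lt.1 (hA x ((le_max_left A 0).trans hx.1)))
    simpa [intervalIntegral.integral_const, smul_eq_mul] using hmono
  -- upper bound `∫_{A'}^{A'+L} C = t(A'+L) − t(A') < T − 0`
  have h2 : ∫ s in A'..(A' + L), C s < blowupTime C := by
    have hadd := rescaledTime_add_integral hC A' (A' + L)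
    have hlt := rescaledTime_lt_blowupTime hC hpos hint (A' + L)
    have h0 : 0 ≤ rescaledTime C A' := rescaledTime_nonneg hC hpos (le_max_right A 0)
    linarith
  linarith

end Time

/-! ### The rescaling factor generated by an exponent `c_ω ≤ -a < 0` -/

section Factor

variable {c : ℝ → ℝ}

/-- `C_ω(τ) > 0`. [folklore] -/
theorem rescalingFactor_pos (c : ℝ → ℝ) (τ : ℝ) : 0 < rescalingFactor c τ :=
  Real.exp_pos _

/-- `C_ω(0) = 1` (the normalisation of (4.3)). [folklore] -/
@[simp]
theorem rescalingFactor_zero (c : ℝ → ℝ) : rescalingFactor c 0 = 1 := by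
  simp [rescalingFactor]

/-- `C_ω` is continuous (for a continuous exponent). [folklore] -/
theorem continuous_rescalingFactor (hc : Continuous c) : Continuous (rescalingFactor c) :=
  Real.continuous_exp.comp (continuous_primitive (fun a b => hc.intervalIntegrable a b) 0)

/-- **`C_ω(τ) ≤ e^{−aτ}`** for `τ ≥ 0` when `c_ω ≤ −a` on `[0, ∞)` ([ChenHou2021Boundary], §4.1,
p. 11, first display after (4.4)). [cite: ChenHou2021Boundary, §4.1, p. 11] -/
theorem rescalingFactor_le_exp_neg (hc : Continuous c) {a : ℝ} (hca : ∀ s, 0 ≤ s → c s ≤ -a)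
    {τ : ℝ} (hτ : 0 ≤ τ) : rescalingFactor c τ ≤ Real.exp (-a * τ) := by
  unfold rescalingFactor
  gcongr
  have hmono := integral_mono_on hτ (hc.intervalIntegrable _ _)
    (intervalIntegrable_const (μ := volume)) (fun s hs => hca s hs.1)
  simpa [intervalIntegral.integral_const, smul_eq_mul, mul_comm] using hmono

/-- `C_ω` is integrable on `(0, ∞)` when `c_ω ≤ −a < 0` there (comparison with `e^{−aτ}`), so
that `T = t(∞) < +∞`. [cite: ChenHou2021Boundary, §4.1, p. 11] -/
theorem integrableOn_rescalingFactor (hc : Continuous c) {a : ℝ} (ha : 0 < a)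
    (hca : ∀ s, 0 ≤ s → c s ≤ -a) : IntegrableOn (rescalingFactor c) (Ioi 0) := by
  refine Integrable.mono' (exp_neg_integrableOn_Ioi 0 ha)
    (continuous_rescalingFactor hc).aestronglyMeasurable ?_
  refine ae_restrict_of_forall_mem measurableSet_Ioi fun τ hτ => ?_
  rw [Real.norm_of_nonneg (rescalingFactor_pos c τ).le]
  exact rescalingFactor_le_exp_neg hc hca (le_of_lt hτ)

/-- **`T = t(∞) ≤ ∫₀^∞ e^{−aτ} dτ = a⁻¹ < +∞`** ([ChenHou2021Boundary], §4.1, p. 11).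
[cite: ChenHou2021Boundary, §4.1, p. 11] -/
theorem blowupTime_rescalingFactor_le (hc : Continuous c) {a : ℝ} (ha : 0 < a)
    (hca : ∀ s, 0 ≤ s → c s ≤ -a) : blowupTime (rescalingFactor c) ≤ a⁻¹ := by
  calc blowupTime (rescalingFactor c)
      ≤ ∫ τ in Ioi (0 : ℝ), Real.exp (-a * τ) :=
        setIntegral_mono_on (integrableOn_rescalingFactor hc ha hca) (exp_neg_integrableOn_Ioi 0 ha)
          measurableSet_Ioi (fun τ hτ => rescalingFactor_le_exp_neg hc hca (le_of_lt hτ))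
    _ = a⁻¹ := by
        rw [integral_exp_mul_Ioi (neg_lt_zero.2 ha) 0, mul_zero, Real.exp_zero, neg_div_neg_eq,
          one_div]

/-- **The printed blow-up statement** ([ChenHou2021Boundary], §4.1, p. 11): if `c_ω ≤ −a < 0` on
`[0, ∞)` and the rescaled solution stays nontrivial, `‖ω̃(τ)‖ ≥ m > 0` — written for an arbitrary
physical size functional `N` (e.g. `N(t) = ‖ω(t)‖_{L^∞}`) through the rescaling relation (4.1),
`‖ω̃(τ)‖ = C_ω(τ) N(t(τ))` — then `N(t(τ)) ≥ e^{aτ} m` and `N(s) → +∞` as `s ↑ T = t(∞)`.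
[cite: ChenHou2021Boundary, §4.1, p. 11] -/
theorem tendsto_atTop_nhdsLT_of_rescalingFactor (hc : Continuous c) {a : ℝ} (ha : 0 < a)
    (hca : ∀ s, 0 ≤ s → c s ≤ -a) {N : ℝ → ℝ} {m : ℝ} (hm : 0 < m)
    (hN : ∀ τ, 0 ≤ τ → m ≤ rescalingFactor c τ * N (rescaledTime (rescalingFactor c) τ)) :
    Tendsto N (𝓝[<] (blowupTime (rescalingFactor c))) atTop := by
  have hC := continuous_rescalingFactor hc
  have hpos := rescalingFactor_pos c
  have hint := integrableOn_rescalingFactor hc ha hca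
  refine tendsto_nhdsLT_of_tendsto_comp_atTop (continuous_rescaledTime hC)
    (tendsto_rescaledTime hint) (rescaledTime_lt_blowupTime hC hpos hint) ?_
  -- `N (t τ) ≥ m e^{aτ} → ∞`
  have hexp : Tendsto (fun τ => m * Real.exp (a * τ)) atTop atTop :=
    (Real.tendsto_exp_atTop.comp (tendsto_id.const_mul_atTop ha)).const_mul_atTop hm
  refine tendsto_atTop_mono' atTop ?_ hexp
  filter_upwards [eventually_ge_atTop 0] with τ hτ
  have h1 := hN τ hτ
  have hle := rescalingFactor_le_exp_neg hc hca hτ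
  have hN0 : 0 ≤ N (rescaledTime (rescalingFactor c) τ) := by
    by_contra hneg
    have : rescalingFactor c τ * N (rescaledTime (rescalingFactor c) τ) < 0 :=
      mul_neg_of_pos_of_neg (hpos τ) (not_le.1 hneg)
    linarith
  have h2 : m ≤ Real.exp (-a * τ) * N (rescaledTime (rescalingFactor c) τ) :=
    h1.trans (mul_le_mul_of_nonneg_right hle hN0)
  calc m * Real.exp (a * τ)
      ≤ Real.exp (-a * τ) * N (rescaledTime (rescalingFactor c) τ) * Real.exp (a * τ) :=
        mul_le_mul_of_nonneg_right h2 (Real.exp_pos _).le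
    _ = N (rescaledTime (rescalingFactor c) τ) := by
        rw [neg_mul, Real.exp_neg]
        field_simp

end Factor

/-! ### The `limsup` form: blow-up inside a domain from pointwise rescaled lower bounds -/

section Limsup

variable {C : ℝ → ℝ}

/-- **Blow-up in the `limsup` sense from dynamic rescaling, without a decay rate.** Let the factor
`C = C_ω` be continuous, positive and integrable on `(0, ∞)` (i.e. `T = t(∞) < ∞`), and suppose
that for all large `τ` some point `x_τ ∈ Ω` carries the rescaled lower bound
`m ≤ C(τ) · F(t(τ), x_τ)` with `m > 0` (for vorticity: `|ω̃(ξ_τ, τ)| ≥ m` at a point whose physical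
image `x_τ = C_l(τ) ξ_τ + x₀` lies in `Ω`, by (4.1)). Then for every `M`, at physical times
arbitrarily close to `T` from below some point of `Ω` has `F > M` (because `liminf C = 0`,
`frequently_lt_of_integrableOn`). [folklore] -/
theorem frequently_exists_lt_nhdsLT_of_rescaling (hC : Continuous C) (hpos : ∀ τ, 0 < C τ)
    (hint : IntegrableOn C (Ioi 0)) {X : Type*} {Ω : Set X} {F : ℝ → X → ℝ} {m : ℝ} (hm : 0 < m)
    (hF : ∀ᶠ τ in atTop, ∃ x ∈ Ω, m ≤ C τ * F (rescaledTime C τ) x) (M : ℝ) :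
    ∃ᶠ s in 𝓝[<] (blowupTime C), ∃ x ∈ Ω, M < F s x := by
  refine frequently_nhdsLT_of_frequently_atTop (tendsto_rescaledTime hint)
    (Eventually.of_forall (rescaledTime_lt_blowupTime hC hpos hint)) ?_
  have hε : 0 < m / (|M| + 1) := div_pos hm (by positivity)
  refine ((frequently_lt_of_integrableOn hC hpos hint hε).and_eventually hF).mono ?_
  rintro τ ⟨hτε, x, hx, hmx⟩
  refine ⟨x, hx, ?_⟩
  have hCτ := hpos τ
  -- `F ≥ m / C τ > m / ε = |M| + 1 > M`
  have hF1 : m / C τ ≤ F (rescaledTime C τ) x := by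
    rw [div_le_iff₀ hCτ, mul_comm]
    exact hmx
  have hF2 : m / (m / (|M| + 1)) < m / C τ := div_lt_div_of_pos_left hm hCτ hτε
  have hF3 : m / (m / (|M| + 1)) = |M| + 1 := by
    field_simp
  have hM : M ≤ |M| := le_abs_self M
  linarith

end Limsup

end Literature.Analysis.FluidPDE

namespace Literature.Analysis.FluidPDE

/-- Local notation for physical space `ℝ³ = EuclideanSpace ℝ (Fin 3)`. -/
local notation "ℝ³" => EuclideanSpace ℝ (Fin 3)

/-- **Vorticity blow-up inside `Ω` at `T = t(∞)` from dynamic rescaling**: if the vorticity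
rescaling factor `C_ω` is continuous, positive, with `T = ∫₀^∞ C_ω < ∞`, and for all large
rescaled times some point `x_τ ∈ Ω` has `m ≤ C_ω(τ) ‖ω(t(τ), x_τ)‖` (`= |ω̃(ξ_τ, τ)|` by
[ChenHou2021Boundary], (4.1)) with `m > 0`, then `NS.VorticityBlowsUpOnAt Ω u T`. This is the
passage "from nonlinear stability to finite time blowup" of Chen–Hou (CMP 2021 §4.1 p. 11 and
§8.6.2; Part I arXiv:2210.07191 §6.5 p. 66) in the accepted blow-up vocabulary. [folklore] -/
theorem vorticityBlowsUpOnAt_of_rescaling {C : ℝ → ℝ} (hC : Continuous C) (hpos : ∀ τ, 0 < C τ)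
    (hint : IntegrableOn C (Ioi 0)) {Ω : Set ℝ³} {u : ℝ → ℝ³ → ℝ³} {m : ℝ} (hm : 0 < m)
    (h : ∀ᶠ τ in atTop, ∃ x ∈ Ω, m ≤ C τ * ‖FluidPDE.curl (u (FluidPDE.rescaledTime C τ)) x‖) :
    VorticityBlowsUpOnAt Ω u (FluidPDE.blowupTime C) := fun M =>
  FluidPDE.frequently_exists_lt_nhdsLT_of_rescaling hC hpos hint hm
    (F := fun s x => ‖FluidPDE.curl (u s) x‖) h M

/-- **Blow-up of a scalar component inside `Ω` at `T = t(∞)` from dynamic rescaling** (the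
form of the last conjunct of `NS.ChenHou2022_axisymmetricEulerBlowup`, with
`ω t = NS.angularVorticity (u t)` the angular vorticity `ω^θ`): as
`vorticityBlowsUpOnAt_of_rescaling`, with a scalar field `|ω(t, x)|` in place of `‖curl u(t, x)‖`
(Chen–Hou Part I, §6, p. 53: the rescaled variable is `C_ω(τ) ω̃(…, t(τ))` with `ω̃ = ω^θ / r`,
and `r ≥ 1/2` on the support, p. 82, so `|ω̃| ≍ |ω^θ|`). [folklore] -/
theorem scalar_blowup_of_rescaling {C : ℝ → ℝ} (hC : Continuous C)
    (hpos : ∀ τ, 0 < C τ) (hint : IntegrableOn C (Ioi 0)) {Ω : Set ℝ³} {ω : ℝ → ℝ³ → ℝ}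
    {m : ℝ} (hm : 0 < m)
    (h : ∀ᶠ τ in atTop, ∃ x ∈ Ω, m ≤ C τ * |ω (FluidPDE.rescaledTime C τ) x|) (M : ℝ) :
    ∃ᶠ t in 𝓝[<] (FluidPDE.blowupTime C), ∃ x ∈ Ω, M < |ω t x| :=
  FluidPDE.frequently_exists_lt_nhdsLT_of_rescaling hC hpos hint hm
    (F := fun s x => |ω s x|) h M

end Literature.Analysis.FluidPDE
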